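import Summits.QuantumFields.YangMills.Theorems.FemtoCutoffLadderTraceDefs
import Summits.QuantumFields.YangMills.Theorems.FemtoTransferGapExcitedTrace

/-!
# Crux `OctaveStepDecay` (stmt-QuantumFields-24153), registered skeleton `trace` — STUB `stub_excitedRatioUpper` LANDED

Lead seat `ym-line-fcl-p1` (2026-08-28).  `ExcitedRatioUpper` (`Theorems/FemtoCutoffLadderTraceDefs.lean`, verbatim the skeleton's Prop):
`E(T) ≤ (λ₁/λ₀)^{T−2}·E(2)` on the window for `T ≥ 2`, `E(T) = Z_phys(T)/λ₀^T − 1` — is `physTrace_excited_upper`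
(`FemtoTransferGapExcitedTrace.lean`, p591910) with `excitedRatio` unfolded.  After this the trace skeleton's ONLY open stub is
`stub_towerTraceComparison` (two-cutoff comparison of zero-flux partition functions along one dyadic tower; behind `UVStabilityNonUniqueness`).
HONEST FRAMING: fixed-lattice bookkeeping; R2b1 is a RECORD rung — not infinite volume, not a mass gap, not Clay.  No definitions, no `sorry`.
-/

set_option autoImplicit false

namespace Summit.QuantumFields.YangMills.Cruxes.OctaveStepDecay.Trace

open Summit.QuantumFields.YangMills.Theorems.FemtoCutoffLadder.Trace
open Summit.QuantumFields.YangMills.Theorems.FemtoTransferGap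

/-- ★ Registered stub `stub_excitedRatioUpper` of the `trace` skeleton on crux `OctaveStepDecay`: first-term domination of the excited trace
ratio, `E(T) ≤ (λ₁/λ₀)^{T−2}·E(2)`. [cite: ReedSimonIV1978, Thm. XIII.1] [cite: MontvayMunster1994, (3.145)] -/
theorem stub_excitedRatioUpper : ExcitedRatioUpper := by
  intro lam L _ β T hW hT
  unfold excitedRatio
  exact physTrace_excited_upper hW hT

end Summit.QuantumFields.YangMills.Cruxes.OctaveStepDecay.Trace
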